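import Summits.CriticalPhenomena.PercolationContinuityZ3.Theorems.Transplant.FKConnectivityAllQPat3KNetOps
import HarnessLib

/-!
# Connectivity correlation inequalities for `φ_{w,q}`, every `q > 0` — the class 𝒦: RE-ROOTING A BRIDGE AT A SLOT («views»)

Proof file (`--supports stmt-CriticalPhenomena-4575`), census lineage (gen 41) of LANE 2's FK sub-programme; builds on p205010
(kernel theorem, internal audit signed; external expert review pending).  No definitions, no named facts, no sorries.

Census g39 §3's «view at a slot `e = uv`» of a bridge `N = BRIDGE(Qac, Qad, Qbc, Qbd, Qcd; a, b)`: `N` is also a 𝒦-network between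
the ENDS of any of its slots, namely `Q_e ∥ (N ∖ Q_e)` with `N ∖ Q_e` a series–parallel composition of the other four slots re-rooted at
`u, v`.  This is what THEOREM SP(𝒦)'s bridge dispatch uses when two marks sit in one slot (recurse into the parallel composition at
that slot) — memo HOME/FROM-census-g41-T2K-KSTATES.md §5:
* **`FK.IsKNet.bridge_rest_cd / _rest_ac / _rest_ad / _rest_bc / _rest_bd`** — `N ∖ Q_e` is a 𝒦-network between the ends of `e`;
* **`FK.IsKNet.bridge_view_cd / _view_ac`** — `N` itself is a 𝒦-network between `c, d` / between `a, c` (the other slots by the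
  symmetries `FK.BridgeSep.symm / swap_cd`, exactly as `…Pat3KNetT2` dispatches).
[cite: AyyerLinussonRavichandran2025, §7 (p. 22)] [cite: Grimmett2006, §3.9 (pp. 63–64)]
-/

namespace Summit.CriticalPhenomena.PercolationContinuityZ3.Theorems

namespace FK

open scoped Classical

variable {V : Type*} {Qac Qad Qbc Qbd Qcd : Finset (Sym2 V)} {a b c d : V}

/-- **The bridge minus the slot `cd`, re-rooted at `c, d`**: `(Qca ·_a Qad) ∥ (Qcb ·_b Qbd)` is a 𝒦-network between `c` and `d`. [folklore] -/
theorem IsKNet.bridge_rest_cd (hac : IsKNet Qac a c) (had : IsKNet Qad a d) (hbc : IsKNet Qbc b c) (hbd : IsKNet Qbd b d)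
    (hsep : BridgeSep Qac Qad Qbc Qbd Qcd a b c d) : IsKNet (Qac ∪ Qad ∪ Qbc ∪ Qbd) c d := by
  have h₁ : IsKNet (Qac ∪ Qad) c d := hac.symm.series_via had.symm hsep.d_ac_ad hsep.v_ac_ad
  have h₂ : IsKNet (Qbc ∪ Qbd) c d := hbc.symm.series_via hbd.symm hsep.d_bc_bd hsep.v_bc_bd
  have hE : Qac ∪ Qad ∪ Qbc ∪ Qbd = (Qac ∪ Qad) ∪ (Qbc ∪ Qbd) := by ac_rfl
  rw [hE]
  refine IsKNet.parallel h₁ h₂ ?_ ?_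
  · exact Finset.disjoint_union_left.2 ⟨Finset.disjoint_union_right.2 ⟨hsep.d_ac_bc, hsep.d_ac_bd⟩,
      Finset.disjoint_union_right.2 ⟨hsep.d_ad_bc, hsep.d_ad_bd⟩⟩
  · intro z hz₁ hz₂
    obtain ⟨e, he, hze⟩ := hz₁
    obtain ⟨f, hf, hzf⟩ := hz₂
    rcases Finset.mem_union.1 he with he | he <;> rcases Finset.mem_union.1 hf with hf | hf
    · exact Or.inl (hsep.v_ac_bc z ⟨e, he, hze⟩ ⟨f, hf, hzf⟩)
    · exact (hsep.v_ac_bd z ⟨e, he, hze⟩ ⟨f, hf, hzf⟩).elim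
    · exact (hsep.v_ad_bc z ⟨e, he, hze⟩ ⟨f, hf, hzf⟩).elim
    · exact Or.inr (hsep.v_ad_bd z ⟨e, he, hze⟩ ⟨f, hf, hzf⟩)

/-- **The bridge minus the slot `ac`, re-rooted at `a, c`**: `Qad ·_d ((Qdb ·_b Qbc) ∥ Qdc)` is a 𝒦-network between `a` and `c`. [folklore] -/
theorem IsKNet.bridge_rest_ac (had : IsKNet Qad a d) (hbc : IsKNet Qbc b c) (hbd : IsKNet Qbd b d) (hcd : IsKNet Qcd c d)
    (hsep : BridgeSep Qac Qad Qbc Qbd Qcd a b c d) : IsKNet (Qad ∪ Qbc ∪ Qbd ∪ Qcd) a c := by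
  -- the path `d — b — c`
  have hP : IsKNet (Qbd ∪ Qbc) d c := hbd.symm.series_via hbc.symm hsep.d_bc_bd.symm (fun z h₁ h₂ => hsep.v_bc_bd z h₂ h₁)
  -- in parallel with the slot `dc`, between `d` and `c`
  have hR : IsKNet (Qbd ∪ Qbc ∪ Qcd) d c := by
    refine IsKNet.parallel hP hcd.symm (Finset.disjoint_union_left.2 ⟨hsep.d_bd_cd, hsep.d_bc_cd⟩) ?_
    intro z hz₁ hz₂
    obtain ⟨e, he, hze⟩ := hz₁
    rcases Finset.mem_union.1 he with he | he
    · exact Or.inl (hsep.v_bd_cd z ⟨e, he, hze⟩ hz₂)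
    · exact Or.inr (hsep.v_bc_cd z ⟨e, he, hze⟩ hz₂)
  -- in series after the slot `ad`, at `d`
  have hE : Qad ∪ Qbc ∪ Qbd ∪ Qcd = Qad ∪ (Qbd ∪ Qbc ∪ Qcd) := by ac_rfl
  rw [hE]
  refine IsKNet.series had hR ?_ ?_ ?_ ?_
  · exact Finset.disjoint_union_right.2 ⟨Finset.disjoint_union_right.2 ⟨hsep.d_ad_bd, hsep.d_ad_bc⟩, hsep.d_ad_cd⟩
  · intro z hz₁ hz₂
    obtain ⟨f, hf, hzf⟩ := hz₂
    simp only [Finset.mem_union] at hf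
    rcases hf with (hf | hf) | hf
    · exact hsep.v_ad_bd z hz₁ ⟨f, hf, hzf⟩
    · exact (hsep.v_ad_bc z hz₁ ⟨f, hf, hzf⟩).elim
    · exact hsep.v_ad_cd z hz₁ ⟨f, hf, hzf⟩
  · intro f hf haf
    simp only [Finset.mem_union] at hf
    rcases hf with (hf | hf) | hf
    · exact had.ne (hsep.v_ad_bd a had.left_mem ⟨f, hf, haf⟩)
    · exact hsep.v_ad_bc a had.left_mem ⟨f, hf, haf⟩
    · exact had.ne (hsep.v_ad_cd a had.left_mem ⟨f, hf, haf⟩)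
  · intro e he hce
    exact hcd.ne (hsep.v_ad_cd c ⟨e, he, hce⟩ hcd.left_mem)

/-- **The bridge minus the slot `ad`, re-rooted at `a, d`** (swap `c ↔ d`). [folklore] -/
theorem IsKNet.bridge_rest_ad (hac : IsKNet Qac a c) (hbc : IsKNet Qbc b c) (hbd : IsKNet Qbd b d) (hcd : IsKNet Qcd c d)
    (hsep : BridgeSep Qac Qad Qbc Qbd Qcd a b c d) : IsKNet (Qac ∪ Qbc ∪ Qbd ∪ Qcd) a d := by
  have h := IsKNet.bridge_rest_ac hac hbd hbc hcd.symm hsep.swap_cd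
  have hE : Qac ∪ Qbc ∪ Qbd ∪ Qcd = Qac ∪ Qbd ∪ Qbc ∪ Qcd := by ac_rfl
  rw [hE]; exact h

/-- **The bridge minus the slot `bc`, re-rooted at `b, c`** (swap the poles). [folklore] -/
theorem IsKNet.bridge_rest_bc (hac : IsKNet Qac a c) (had : IsKNet Qad a d) (hbd : IsKNet Qbd b d) (hcd : IsKNet Qcd c d)
    (hsep : BridgeSep Qac Qad Qbc Qbd Qcd a b c d) : IsKNet (Qac ∪ Qad ∪ Qbd ∪ Qcd) b c := by
  have h := IsKNet.bridge_rest_ac hbd hac had hcd hsep.symm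
  have hE : Qac ∪ Qad ∪ Qbd ∪ Qcd = Qbd ∪ Qac ∪ Qad ∪ Qcd := by ac_rfl
  rw [hE]; exact h

/-- **The bridge minus the slot `bd`, re-rooted at `b, d`** (swap the poles and `c ↔ d`). [folklore] -/
theorem IsKNet.bridge_rest_bd (hac : IsKNet Qac a c) (had : IsKNet Qad a d) (hbc : IsKNet Qbc b c) (hcd : IsKNet Qcd c d)
    (hsep : BridgeSep Qac Qad Qbc Qbd Qcd a b c d) : IsKNet (Qac ∪ Qad ∪ Qbc ∪ Qcd) b d := by
  have h := IsKNet.bridge_rest_ad hbc hac had hcd hsep.symm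
  have hE : Qac ∪ Qad ∪ Qbc ∪ Qcd = Qbc ∪ Qac ∪ Qad ∪ Qcd := by ac_rfl
  rw [hE]; exact h

/-- **VIEW AT THE SLOT `cd`**: the whole bridge is a 𝒦-network between `c` and `d`: `Qcd ∥ (N ∖ Qcd)`. [folklore] -/
theorem IsKNet.bridge_view_cd (hac : IsKNet Qac a c) (had : IsKNet Qad a d) (hbc : IsKNet Qbc b c) (hbd : IsKNet Qbd b d)
    (hcd : IsKNet Qcd c d) (hsep : BridgeSep Qac Qad Qbc Qbd Qcd a b c d) : IsKNet (Qac ∪ Qad ∪ Qbc ∪ Qbd ∪ Qcd) c d := by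
  have hE : Qac ∪ Qad ∪ Qbc ∪ Qbd ∪ Qcd = Qcd ∪ (Qac ∪ Qad ∪ Qbc ∪ Qbd) := by ac_rfl
  rw [hE]
  refine IsKNet.parallel hcd (IsKNet.bridge_rest_cd hac had hbc hbd hsep) ?_ ?_
  · exact Finset.disjoint_union_right.2 ⟨Finset.disjoint_union_right.2 ⟨Finset.disjoint_union_right.2
      ⟨hsep.d_ac_cd.symm, hsep.d_ad_cd.symm⟩, hsep.d_bc_cd.symm⟩, hsep.d_bd_cd.symm⟩
  · intro z hz₁ hz₂
    obtain ⟨f, hf, hzf⟩ := hz₂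
    simp only [Finset.mem_union] at hf
    rcases hf with ((hf | hf) | hf) | hf
    · exact Or.inl (hsep.v_ac_cd z ⟨f, hf, hzf⟩ hz₁)
    · exact Or.inr (hsep.v_ad_cd z ⟨f, hf, hzf⟩ hz₁)
    · exact Or.inl (hsep.v_bc_cd z ⟨f, hf, hzf⟩ hz₁)
    · exact Or.inr (hsep.v_bd_cd z ⟨f, hf, hzf⟩ hz₁)

/-- **VIEW AT THE SLOT `ac`**: the whole bridge is a 𝒦-network between `a` and `c`: `Qac ∥ (N ∖ Qac)`. [folklore] -/
theorem IsKNet.bridge_view_ac (hac : IsKNet Qac a c) (had : IsKNet Qad a d) (hbc : IsKNet Qbc b c) (hbd : IsKNet Qbd b d)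
    (hcd : IsKNet Qcd c d) (hsep : BridgeSep Qac Qad Qbc Qbd Qcd a b c d) : IsKNet (Qac ∪ Qad ∪ Qbc ∪ Qbd ∪ Qcd) a c := by
  have hE : Qac ∪ Qad ∪ Qbc ∪ Qbd ∪ Qcd = Qac ∪ (Qad ∪ Qbc ∪ Qbd ∪ Qcd) := by ac_rfl
  rw [hE]
  refine IsKNet.parallel hac (IsKNet.bridge_rest_ac had hbc hbd hcd hsep) ?_ ?_
  · exact Finset.disjoint_union_right.2 ⟨Finset.disjoint_union_right.2 ⟨Finset.disjoint_union_right.2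
      ⟨hsep.d_ac_ad, hsep.d_ac_bc⟩, hsep.d_ac_bd⟩, hsep.d_ac_cd⟩
  · intro z hz₁ hz₂
    obtain ⟨f, hf, hzf⟩ := hz₂
    simp only [Finset.mem_union] at hf
    rcases hf with ((hf | hf) | hf) | hf
    · exact Or.inl (hsep.v_ac_ad z hz₁ ⟨f, hf, hzf⟩)
    · exact Or.inr (hsep.v_ac_bc z hz₁ ⟨f, hf, hzf⟩)
    · exact (hsep.v_ac_bd z hz₁ ⟨f, hf, hzf⟩).elim
    · exact Or.inr (hsep.v_ac_cd z hz₁ ⟨f, hf, hzf⟩)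

end FK

end Summit.CriticalPhenomena.PercolationContinuityZ3.Theorems
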